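import Mathlib
import HarnessLib

/-!
# Fine-weight admissibility, part 2: splitting the transfer product of an ODD time circle
(crux stmt-QuantumFields-18031 `HeatSlicedQuarks.InterleavedFlowProper`, line `Sketch`,
stub `stub_fineWeightAdmissible`, clause (6) — pure matrix algebra)

Lüscher's transfer-matrix formula writes the antiperiodic Wilson fermion determinant of a gauge
field on a time circle of length `N` as `(∏ det a_t) · det (1 + Λ_{N-1}ᴴ Y_{N-1} ⋯ Λ₀ᴴ Y₀)`
(`Literature.LinearAlgebra.Matrix.det_wilsonBlock_antiperiodic`; `Λ_t` = doubled temporal link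
block of the layer `t → t+1`, `Y_t` = Hermitian transfer step of the slice `t`). For an EVEN circle
the tree splits the product at the two site-reflection slices
(`Literature.LinearAlgebra.Matrix.reverse_prod_transfer_reflect`). Here we treat the ODD circle
`N = 2S + 1` in the coordinates of the tree's link reflection `θ t = 1 - t`
(`GaugeConfig.timeReflect`), which fixes ONE layer of links (`0 → 1`, the crossing layer) and ONE
slice (`t = S + 1`, the shared slice): if the crossing block factorises as `Λ₀ = A · B`
(Osterwalder–Seiler's splitting `U_c ↦ U_c Y_c` of the crossing links), then

  `det (1 + Λ_{2S}ᴴ Y_{2S} ⋯ Λ₀ᴴ Y₀) = det (1 + 𝔊ⁿᴴ · Y_{S+1} · 𝔊ᵖ)`,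

`𝔊ᵖ = Λ_Sᴴ Y_S ⋯ Λ₁ᴴ Y₁ Bᴴ` the transfer product of the positive half (slices `1 … S`, layers
`1 → 2, …, S → S+1`, and the `B`-half of the crossing layer) and `𝔊ⁿ = Λ_{-S} Y_{1-S} ⋯ Λ_{-1} Y₀ A`
the same product built from the reflected data `Λⁿ_s = (Λ_{-s})ᴴ`, `Yⁿ_s = Y_{1-s}`, `Λⁿ₀ = Aᴴ`
(`det_one_add_transfer_odd_split`). With the Cauchy–Binet Gram expansion
`Literature.LinearAlgebra.Matrix.det_one_add_eq_sum_gram` (at `Y₀ = 1`) this exhibits the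
antiperiodic determinant on the odd torus as a reflection-positive Gram kernel (part 3).

The proof is bookkeeping of ordered products, done over `ℕ`-indexed lists (`List.range`): a split
`N = (S+1) + S`, the cyclic invariance `det (1 + XY) = det (1 + YX)`, and a telescoping
regrouping of the negative half. All statements are proved; no definitions.

References: M. Lüscher, Commun. Math. Phys. 54 (1977) 283, §3; K. Osterwalder, E. Seiler,
Ann. Phys. 110 (1978) 440, §2; I. Montvay, G. Münster, *Quantum Fields on a Lattice* (1994) §4.2.3.
-/

namespace Summit.QuantumFields.QCD.Cruxes.InterleavedFlowProper.OffsetLastFormatHandover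

namespace FineWeight

open Matrix

/-! ## Ordered products over `List.range` -/

section Lists

variable {M : Type*} [Monoid M]

omit [Monoid M] in
/-- An `ofFn` list is a `range` list of any total extension of the family. -/
theorem ofFn_eq_map_range {n : ℕ} (g : Fin n → M) (g' : ℕ → M) (hg : ∀ i : Fin n, g' i = g i) :
    List.ofFn g = (List.range n).map g' := by
  rw [List.ofFn_eq_map, ← List.map_coe_finRange_eq_range, List.map_map]
  exact List.map_congr_left fun i _ => (hg i).symm

/-- Splitting a descending product: `∏↓_{i < a + b} f i = (∏↓_{j < b} f (a + j)) · (∏↓_{i < a} f i)`. -/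
theorem reverse_prod_map_range_add (f : ℕ → M) (a b : ℕ) :
    ((List.range (a + b)).map f).reverse.prod =
      ((List.range b).map fun j => f (a + j)).reverse.prod * ((List.range a).map f).reverse.prod := by
  rw [List.range_add, List.map_append, List.reverse_append, List.prod_append, List.map_map]
  rfl

/-- Peeling the first factor off a descending product. -/
theorem reverse_prod_map_range_succ_first (f : ℕ → M) (a : ℕ) :
    ((List.range (a + 1)).map f).reverse.prod =
      ((List.range a).map fun j => f (j + 1)).reverse.prod * f 0 := by
  rw [List.range_succ_eq_map, List.map_cons, List.reverse_cons, List.prod_append, List.prod_singleton,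
    List.map_map]
  rfl

/-- A descending product over `range n` is the ascending product of the reflected family. -/
theorem reverse_prod_map_range_eq (f : ℕ → M) (n : ℕ) :
    ((List.range n).map f).reverse.prod = ((List.range n).map fun j => f (n - 1 - j)).prod := by
  rw [← List.map_reverse, List.range_eq_range', List.reverse_range', List.map_map]
  simp only [zero_add, Function.comp_def, ← List.range_eq_range']

/-- **Telescoping regrouping**: `(∏_{j<k} B_j A_j) · B_k = B_0 · ∏_{j<k} (A_j B_{j+1})` (ascending
products). -/
theorem prod_map_range_telescope (A B : ℕ → M) : ∀ k : ℕ,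
    ((List.range k).map fun j => B j * A j).prod * B k = B 0 * ((List.range k).map fun j => A j * B (j + 1)).prod
  | 0 => by simp
  | k + 1 => by
    rw [List.range_succ, List.map_append, List.prod_append, List.map_singleton, List.prod_singleton,
      List.map_append, List.prod_append, List.map_singleton, List.prod_singleton, ← mul_assoc (B 0),
      ← prod_map_range_telescope A B k]
    simp only [mul_assoc]

end Lists

/-! ## The odd splitting -/

section OddSplit

variable {ι : Type*} [Fintype ι] [DecidableEq ι] {R : Type*} [CommRing R] [StarRing R]

/-- The conjugate transpose of an ascending product of `Λᴴ Y` factors with Hermitian `Y`. -/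
theorem conjTranspose_prod_map_range (Λ' Y' : ℕ → Matrix ι ι R) (hY : ∀ j, (Y' j)ᴴ = Y' j) (n : ℕ) :
    (((List.range n).map fun j => (Λ' j)ᴴ * Y' j).reverse.prod)ᴴ =
      ((List.range n).map fun j => Y' j * Λ' j).prod := by
  rw [Matrix.conjTranspose_list_prod, List.map_reverse, List.reverse_reverse, List.map_map]
  refine congrArg List.prod (List.map_congr_left fun j _ => ?_)
  simp only [Function.comp_apply, Matrix.conjTranspose_mul, Matrix.conjTranspose_conjTranspose, hY]

/-- **Splitting of the transfer product of a reflection-symmetric ODD circle** `Fin (2S+1)`,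
`S ≥ 1`, in the link-reflection coordinates `t ↦ 1 - t` (crossing layer `0 → 1`, shared slice
`S + 1`). Let `Y_t` be Hermitian and let the crossing block factorise, `Λ₀ = A · B`. Let
`Λᵖ, Yᵖ` be the positive-half data (`Λᵖ₀ = B`, `Λᵖ_s = Λ_s`, `Yᵖ_s = Y_s` for `1 ≤ s ≤ S`) and
`Λⁿ, Yⁿ` the reflected data (`Λⁿ₀ = Aᴴ`, `Λⁿ_s = (Λ_{-s})ᴴ`, `Yⁿ_s = Y_{1-s}`). Then
`det (1 + Λ_{2S}ᴴ Y_{2S} ⋯ Λ₀ᴴ Y₀) = det (1 + (𝔊 Λⁿ Yⁿ)ᴴ · Y_{S+1} · 𝔊 Λᵖ Yᵖ)` with the half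
transfer product `𝔊 Λ Y = Λ_Sᴴ Y_S ⋯ Λ₁ᴴ Y₁ Λ₀ᴴ`. -/
theorem det_one_add_transfer_odd_split (S : ℕ) (hS : 1 ≤ S)
    (Λ Y : Fin (2 * S + 1) → Matrix ι ι R) (A B : Matrix ι ι R)
    (Λp Yp Λn Yn : Fin (S + 1) → Matrix ι ι R)
    (hY : ∀ t, (Y t)ᴴ = Y t) (h0 : Λ 0 = A * B)
    (hΛp0 : Λp 0 = B)
    (hΛp : ∀ s : Fin (S + 1), (s : ℕ) ≠ 0 → Λp s = Λ (Fin.castLE (by omega) s))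
    (hYp : ∀ s : Fin (S + 1), (s : ℕ) ≠ 0 → Yp s = Y (Fin.castLE (by omega) s))
    (hΛn0 : Λn 0 = Aᴴ)
    (hΛn : ∀ s : Fin (S + 1), (s : ℕ) ≠ 0 → Λn s = (Λ (-Fin.castLE (by omega) s))ᴴ)
    (hYn : ∀ s : Fin (S + 1), (s : ℕ) ≠ 0 → Yn s = Y (1 - Fin.castLE (by omega) s)) :
    (1 + (List.ofFn fun t => (Λ t)ᴴ * Y t).reverse.prod).det =
      (1 + ((List.ofFn fun s : Fin (S + 1) => (Λn s)ᴴ * (if (s : ℕ) = 0 then 1 else Yn s)).reverse.prod)ᴴ *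
        Y ⟨S + 1, by omega⟩ *
        (List.ofFn fun s : Fin (S + 1) => (Λp s)ᴴ * (if (s : ℕ) = 0 then 1 else Yp s)).reverse.prod).det := by
  -- total extensions of the families to `ℕ`
  set Λ' : ℕ → Matrix ι ι R := fun i => if h : i < 2 * S + 1 then Λ ⟨i, h⟩ else 1 with hΛ'
  set Y' : ℕ → Matrix ι ι R := fun i => if h : i < 2 * S + 1 then Y ⟨i, h⟩ else 1 with hY'
  have hΛ'v : ∀ (i : ℕ) (h : i < 2 * S + 1), Λ' i = Λ ⟨i, h⟩ := fun i h => by simp only [hΛ', dif_pos h]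
  have hY'v : ∀ (i : ℕ) (h : i < 2 * S + 1), Y' i = Y ⟨i, h⟩ := fun i h => by simp only [hY', dif_pos h]
  set g : ℕ → Matrix ι ι R := fun i => (Λ' i)ᴴ * Y' i with hg
  have hgv : ∀ (i : ℕ) (h : i < 2 * S + 1), g i = (Λ ⟨i, h⟩)ᴴ * Y ⟨i, h⟩ := fun i h => by
    simp only [hg, hΛ'v i h, hY'v i h]
  have hY'h : ∀ j, (Y' j)ᴴ = Y' j := fun j => by
    by_cases h : j < 2 * S + 1
    · rw [hY'v j h, hY]
    · simp only [hY', dif_neg h, Matrix.conjTranspose_one]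
  -- the full product, split as (negative half) · Q · Λ₀ᴴ Y₀
  set Q : Matrix ι ι R := ((List.range S).map fun j => g (j + 1)).reverse.prod with hQ
  set D₂ : Matrix ι ι R := ((List.range S).map fun j => g (S + 1 + j)).reverse.prod with hD₂
  have hfull : (List.ofFn fun t => (Λ t)ᴴ * Y t).reverse.prod = D₂ * Q * (Bᴴ * Aᴴ * Y 0) := by
    rw [ofFn_eq_map_range (fun t => (Λ t)ᴴ * Y t) g (fun i => by rw [hgv i i.isLt]),
      show List.range (2 * S + 1) = List.range (S + 1 + S) by congr 1; ring, reverse_prod_map_range_add,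
      reverse_prod_map_range_succ_first, Matrix.mul_assoc]
    congr 1
    rw [hgv 0 (by omega), Fin.mk_zero, h0, Matrix.conjTranspose_mul]
  -- the positive half
  have hGp : (List.ofFn fun s : Fin (S + 1) => (Λp s)ᴴ * (if (s : ℕ) = 0 then 1 else Yp s)).reverse.prod =
      Q * Bᴴ := by
    set gp : ℕ → Matrix ι ι R := fun i =>
      if h : i < S + 1 then (Λp ⟨i, h⟩)ᴴ * (if i = 0 then 1 else Yp ⟨i, h⟩) else 1 with hgp
    have hgpv : ∀ (i : ℕ) (h : i < S + 1), gp i = (Λp ⟨i, h⟩)ᴴ * (if i = 0 then 1 else Yp ⟨i, h⟩) :=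
      fun i h => by simp only [hgp, dif_pos h]
    rw [ofFn_eq_map_range _ gp (fun i => by rw [hgpv i i.isLt]), reverse_prod_map_range_succ_first,
      hgpv 0 (by omega), if_pos rfl, Matrix.mul_one, Fin.mk_zero, hΛp0, hQ]
    congr 3
    refine List.map_congr_left fun j hj => ?_
    rw [List.mem_range] at hj
    rw [hgpv (j + 1) (by omega), if_neg (Nat.succ_ne_zero j), hΛp _ (Nat.succ_ne_zero j),
      hYp _ (Nat.succ_ne_zero j), hgv (j + 1) (by omega)]
    rfl
  -- the negative half: `(𝔊 Λⁿ Yⁿ)ᴴ · Y_{S+1} = Aᴴ Y₀ · D₂`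
  have hGn : ((List.ofFn fun s : Fin (S + 1) => (Λn s)ᴴ * (if (s : ℕ) = 0 then 1 else Yn s)).reverse.prod)ᴴ *
      Y ⟨S + 1, by omega⟩ = Aᴴ * Y 0 * D₂ := by
    set gn : ℕ → Matrix ι ι R := fun i =>
      if h : i < S + 1 then (Λn ⟨i, h⟩)ᴴ * (if i = 0 then 1 else Yn ⟨i, h⟩) else 1 with hgn
    have hgnv : ∀ (i : ℕ) (h : i < S + 1), gn i = (Λn ⟨i, h⟩)ᴴ * (if i = 0 then 1 else Yn ⟨i, h⟩) :=
      fun i h => by simp only [hgn, dif_pos h]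
    -- the reflected indices
    have hneg : ∀ (j : ℕ) (hj : j + 1 < S + 1),
        (-(Fin.castLE (by omega) (⟨j + 1, hj⟩ : Fin (S + 1)) : Fin (2 * S + 1))) = ⟨2 * S - j, by omega⟩ := by
      intro j hj
      refine Fin.ext ?_
      rw [Fin.val_neg', Fin.val_castLE, Nat.mod_eq_of_lt (by simp only; omega)]
      simp only
      omega
    have hsub : ∀ (j : ℕ) (hj : j + 1 < S + 1),
        ((1 : Fin (2 * S + 1)) - Fin.castLE (by omega) (⟨j + 1, hj⟩ : Fin (S + 1))) =
          ⟨if j = 0 then 0 else 2 * S + 1 - j, by split_ifs <;> omega⟩ := by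
      intro j hj
      refine Fin.ext ?_
      rw [Fin.val_sub, Fin.val_castLE, Fin.val_one', Nat.mod_eq_of_lt (show 1 < 2 * S + 1 by omega)]
      simp only
      split_ifs with h
      · subst h
        simp
      · rw [show 2 * S + 1 - (j + 1) + 1 = 2 * S + 1 - j by omega, Nat.mod_eq_of_lt (by omega)]
    -- the ascending form of the reflected half product
    set Bt : ℕ → Matrix ι ι R := fun j => if j = 0 then Y 0 else Y' (2 * S + 1 - j) with hBt
    set At : ℕ → Matrix ι ι R := fun j => (Λ' (2 * S - j))ᴴ with hAt
    have hfac : ∀ j, j < S → gn (j + 1) = (At j)ᴴ * Bt j := by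
      intro j hj
      rw [hgnv (j + 1) (by omega), if_neg (Nat.succ_ne_zero j), hΛn _ (Nat.succ_ne_zero j),
        hYn _ (Nat.succ_ne_zero j), hneg j (by omega), hsub j (by omega)]
      simp only [hAt, hBt, hΛ'v (2 * S - j) (by omega), Matrix.conjTranspose_conjTranspose]
      congr 1
      split_ifs with hj0
      · simp only [Fin.mk_zero]
      · rw [hY'v (2 * S + 1 - j) (by omega)]
    have hBtY : ∀ j, (Bt j)ᴴ = Bt j := fun j => by
      simp only [hBt]
      split_ifs
      · exact hY 0
      · exact hY'h _
    rw [ofFn_eq_map_range _ gn (fun i => by rw [hgnv i i.isLt]), reverse_prod_map_range_succ_first,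
      hgnv 0 (by omega), if_pos rfl, Matrix.mul_one, Fin.mk_zero, hΛn0, Matrix.conjTranspose_mul,
      Matrix.conjTranspose_conjTranspose,
      show ((List.range S).map fun j => gn (j + 1)) = (List.range S).map fun j => (At j)ᴴ * Bt j from
        List.map_congr_left fun j hj => hfac j (List.mem_range.1 hj),
      conjTranspose_prod_map_range At Bt hBtY, Matrix.mul_assoc, Matrix.mul_assoc]
    congr 1
    -- telescope: `(∏ Bt_j At_j) · Y_{S+1} = Y₀ · ∏ (At_j Bt_{j+1}) = Y₀ · D₂`
    have hBS : Bt S = Y ⟨S + 1, by omega⟩ := by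
      simp only [hBt, if_neg (show S ≠ 0 by omega)]
      rw [hY'v (2 * S + 1 - S) (by omega)]
      congr 1
      exact Fin.ext (by simp only; omega)
    have hB0 : Bt 0 = Y 0 := by simp only [hBt, if_pos rfl]
    rw [← hBS, prod_map_range_telescope At Bt S, hB0]
    congr 1
    rw [hD₂, reverse_prod_map_range_eq]
    refine congrArg List.prod (List.map_congr_left fun j hj => ?_)
    rw [List.mem_range] at hj
    simp only [hAt, hBt, if_neg (Nat.succ_ne_zero j), hg]
    rw [show S + 1 + (S - 1 - j) = 2 * S - j by omega, show 2 * S + 1 - (j + 1) = 2 * S - j by omega]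
  -- assemble: cyclic invariance of `det (1 + ·)`
  rw [hfull, hGp, hGn, show D₂ * Q * (Bᴴ * Aᴴ * Y 0) = (D₂ * Q * Bᴴ) * (Aᴴ * Y 0) by
    simp only [Matrix.mul_assoc], Matrix.det_one_add_mul_comm]
  simp only [Matrix.mul_assoc]

end OddSplit

section Indices

/-! ## Index arithmetic on the odd circle `Fin (2S + 1)` -/

/-- The reflection `t ↦ -t` on the positive slices: `-(s + 1) = 2S - s` for `s < S`. -/
theorem neg_castLE_succ (S : ℕ) (s : Fin S) :
    (-(Fin.castLE (by omega) s.succ : Fin (2 * S + 1))) = ⟨2 * S - s, by omega⟩ := by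
  refine Fin.ext ?_
  rw [Fin.val_neg', Fin.val_castLE, Fin.val_succ, Nat.mod_eq_of_lt (by omega)]
  simp only
  omega

/-- The link reflection `t ↦ 1 - t` on the positive slices: `1 - (s + 1)` is `0` for `s = 0` and
`2S + 1 - s` for `0 < s < S`. -/
theorem one_sub_castLE_succ (S : ℕ) (s : Fin S) :
    ((1 : Fin (2 * S + 1)) - Fin.castLE (by omega) s.succ) =
      ⟨if (s : ℕ) = 0 then 0 else 2 * S + 1 - s, by split_ifs <;> omega⟩ := by
  have hS : 1 ≤ S := Nat.one_le_of_lt s.isLt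
  refine Fin.ext ?_
  rw [Fin.val_sub, Fin.val_castLE, Fin.val_succ, Fin.val_one', Nat.mod_eq_of_lt (show 1 < 2 * S + 1 by omega)]
  simp only
  split_ifs with h
  · rw [h]
    simp
  · rw [show 2 * S + 1 - (s + 1) + 1 = 2 * S + 1 - s by omega, Nat.mod_eq_of_lt (by omega)]

/-- **Splitting a product over the odd circle along the link reflection**: the slices are the
shared slice `S + 1`, the positive slices `s + 1` (`s < S`) and their mirror images
`1 - (s + 1)`. -/
theorem prod_odd_circle_split {M : Type*} [CommMonoid M] (S : ℕ) (hS : 1 ≤ S) (f : Fin (2 * S + 1) → M) :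
    ∏ t, f t = f ⟨S + 1, by omega⟩ * (∏ s : Fin S, f (Fin.castLE (by omega) s.succ)) *
      ∏ s : Fin S, f (1 - Fin.castLE (by omega) s.succ) := by
  set F : ℕ → M := fun i => if h : i < 2 * S + 1 then f ⟨i, h⟩ else 1 with hF
  have hFv : ∀ (i : ℕ) (h : i < 2 * S + 1), F i = f ⟨i, h⟩ := fun i h => by simp only [hF, dif_pos h]
  have h1 : ∏ t, f t = ∏ i ∈ Finset.range (2 * S + 1), F i := by
    rw [← Fin.prod_univ_eq_prod_range]
    exact Finset.prod_congr rfl fun t _ => by rw [hFv t t.isLt]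
  have h2 : ∏ s : Fin S, f (Fin.castLE (by omega) s.succ) = ∏ i ∈ Finset.Ico 1 (S + 1), F i := by
    rw [Finset.prod_Ico_eq_prod_range, show S + 1 - 1 = S from rfl, ← Fin.prod_univ_eq_prod_range]
    refine Finset.prod_congr rfl fun s _ => ?_
    rw [hFv (1 + s) (by omega)]
    congr 1
    exact Fin.ext (by simp [Nat.add_comm])
  have h3 : ∏ s : Fin S, f (1 - Fin.castLE (by omega) s.succ) = F 0 * ∏ i ∈ Finset.Ico (S + 2) (2 * S + 1), F i := by
    have h3a : ∏ s : Fin S, f (1 - Fin.castLE (by omega) s.succ) =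
        ∏ i ∈ Finset.range S, F (if i = 0 then 0 else 2 * S + 1 - i) := by
      rw [← Fin.prod_univ_eq_prod_range]
      refine Finset.prod_congr rfl fun s _ => ?_
      rw [one_sub_castLE_succ]
      split_ifs with h
      · rw [hFv 0 (by omega)]
      · rw [hFv _ (by omega)]
    rw [h3a, Finset.range_eq_Ico, Finset.prod_eq_prod_Ico_succ_bot hS, if_pos rfl, zero_add]
    congr 1
    have hr := Finset.prod_Ico_reflect F 1 (show S ≤ 2 * S + 1 + 1 by omega)
    rw [show 2 * S + 1 + 1 - S = S + 2 by omega, show 2 * S + 1 + 1 - 1 = 2 * S + 1 by omega] at hr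
    rw [← hr]
    refine Finset.prod_congr rfl fun i hi => ?_
    rw [Finset.mem_Ico] at hi
    rw [if_neg (by omega)]
  rw [h1, h2, h3, Finset.range_eq_Ico, Finset.prod_eq_prod_Ico_succ_bot (show 0 < 2 * S + 1 by omega),
    ← Finset.prod_Ico_consecutive F (show 1 ≤ S + 1 by omega) (show S + 1 ≤ 2 * S + 1 by omega),
    Finset.prod_eq_prod_Ico_succ_bot (show S + 1 < 2 * S + 1 by omega), hFv (S + 1) (by omega)]
  simp only [mul_assoc, mul_comm, mul_left_comm]

end Indices

section Registered

/-- **Registered sub-goal `stubFW_oddSplit` of `stub_fineWeightAdmissible`** (clause (6), the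
algebraic core): the splitting of the transfer product of a reflection-symmetric odd circle with a
factorised crossing block, over `ℂ`. -/
theorem stubFW_oddSplit : ∀ (ι : Type) [Fintype ι] [DecidableEq ι] (S : ℕ) (hS : 1 ≤ S)
    (Λ Y : Fin (2 * S + 1) → Matrix ι ι ℂ) (A B : Matrix ι ι ℂ) (Λp Yp Λn Yn : Fin (S + 1) → Matrix ι ι ℂ),
    (∀ t, (Y t)ᴴ = Y t) → Λ 0 = A * B → Λp 0 = B →
    (∀ s : Fin (S + 1), (s : ℕ) ≠ 0 → Λp s = Λ (Fin.castLE (by omega) s)) →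
    (∀ s : Fin (S + 1), (s : ℕ) ≠ 0 → Yp s = Y (Fin.castLE (by omega) s)) → Λn 0 = Aᴴ →
    (∀ s : Fin (S + 1), (s : ℕ) ≠ 0 → Λn s = (Λ (-Fin.castLE (by omega) s))ᴴ) →
    (∀ s : Fin (S + 1), (s : ℕ) ≠ 0 → Yn s = Y (1 - Fin.castLE (by omega) s)) →
    (1 + (List.ofFn fun t => (Λ t)ᴴ * Y t).reverse.prod).det =
      (1 + ((List.ofFn fun s : Fin (S + 1) => (Λn s)ᴴ * (if (s : ℕ) = 0 then 1 else Yn s)).reverse.prod)ᴴ *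
        Y ⟨S + 1, by omega⟩ *
        (List.ofFn fun s : Fin (S + 1) => (Λp s)ᴴ * (if (s : ℕ) = 0 then 1 else Yp s)).reverse.prod).det :=
  fun _ _ _ S hS Λ Y A B Λp Yp Λn Yn hY h0 hΛp0 hΛp hYp hΛn0 hΛn hYn =>
    det_one_add_transfer_odd_split S hS Λ Y A B Λp Yp Λn Yn hY h0 hΛp0 hΛp hYp hΛn0 hΛn hYn

end Registered

end FineWeight

end Summit.QuantumFields.QCD.Cruxes.InterleavedFlowProper.OffsetLastFormatHandover
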